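import Literature.NumberTheory.Automorphic.JacquetRayShellTrace     -- ★ R2d `Representation.smoothTrace_indicator_shell_eq` (Casselman, shell form)
import Literature.NumberTheory.Automorphic.JacquetRayFitting        -- ★ Jacquet's lemma `Representation.range_fixedPointsMk_eq` (`[V^{K_n}] = V_N^{K_n ∩ M}`)
import Literature.NumberTheory.Automorphic.JacquetRayLevelDepth     -- ★ «LEVEL-DEPTH» `Representation.exists_nhds_forall_fixedPoints_jacquetModule_eq_top`
import Literature.NumberTheory.Automorphic.JacquetRayExponents      -- ★ `Representation.normalizedJacquet_apply`, `jacquetModule_apply_eq_smul_of_normalizedJacquet` (ED. 2, §5)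
import Literature.NumberTheory.Automorphic.CMPrincipalSeriesSpherical  -- ★ `rootDeltaChar_eq_one_of_mem_of_isClosed_of_isCompact` (`δ_P^{1/2} = 1` on `P ∩ K`) (ED. 2, §5)
import Mathlib.Topology.Algebra.OpenSubgroup
import HarnessLib

/-!
# The character on the shells `K_n b K_n` AT EVERY LEVEL: tame level (`K_n ∩ M` acts trivially on `V_N`) ⇒ `tr π(𝟙_{K_n b K_n}) = μ(K_n)·#R·Σ_s θ(b)`;
# wild level (both exponents non-trivial on `K_n ∩ M`) ⇒ `tr π(𝟙_{K_n b K_n}) = 0`; trivial exponents on `K_n ∩ M` ⇒ tame (Casselman 1977 Thm. 5.2 + Jacquet's lemma)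

Topic `NumberTheory/Automorphic`; namespace `Representation` (sequel of ★ R2d `JacquetRayShellTrace`, ★ `JacquetRayFitting`, ★ «LEVEL-DEPTH» `JacquetRayLevelDepth`).
THEOREMS ONLY (no definition, no named fact, no instance, no notation, no `sorry`).  Cell `hodgecm-mathlib`, F0∕P3c∕P3b line LH6 «StCharTS», road (D) «DEEP-FL»
brick **F1-G «R2d-ALL-LEVELS»** (owner LH6-p04 (g2), spec `F0/P3b/LH6-p04/g2/F1G.signature-spec.txt` 15b282cbdfa4785b; desk F0P3b-plan (g23) DEAL 2026-09-02T04:43:57Z to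
LH10-p02 (g2)); lane `--supports stmt-HodgeConjecture-24833`.  ED. 1 = §1–§4 (p849299); ED. 2 appends §5 (normalised-datum form).  HONEST SCOPE: generic (any admissible `π`, any parabolic triple with an Iwahori datum); nothing here is
instantiated at `U(3)`, no letter closes; HC_CM is proved only modulo the 7 printed citations (2 remaining: hLiu418 = stmt-HodgeConjecture-24832, h413 =
stmt-HodgeConjecture-24833) until rung 0 closes.  Consumer: D3-ii «SHELL-ORBITAL» of road (D) (the split-torus orbital integrals of the shell indicators at an ARBITRARY
level `n`, where the depth neighbourhood of ★ `F0P3cStCharTSShellKit.smoothTrace_shell_eq_mul_sum` is not available).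

SETTING (= ★ R2d ∕ the shell kit): `ρ` admissible on a complex vector space `V`, `t = (P, M, N)` a parabolic triple with `N` closed, `𝓘` an Iwahori datum (compact open
`K_n = (K_n ∩ N̄)(K_n ∩ M)(K_n ∩ N)`), `b ∈ M` commuting with `M` and dominant at level `n` (`hbN`, `hbNbar`, `hbexh`), `R` a left transversal of `K_n ∕ (K_n ∩ bK_nb⁻¹)`;
`V_N = (t.restrict ρ).Coinvariants` the Jacquet module with `M`-action `ρ.jacquetModule t`; `C := K_n ∩ M` (as the subgroup `(𝓘.K n).comap t.M.subtype` of `M`).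
By ★ R2d, `tr ρ(𝟙_{K_n b K_n}) = μ(K_n)·#R·tr(ρ_N(b) | [V^{K_n}])`, and by Jacquet's lemma ★ `range_fixedPointsMk_eq`, `[V^{K_n}] = V_N^C`.

THE MATHEMATICS.
* §1 `eq_one_of_sq_sub_one_eq_zero_of_pow_eq_one` — a unipotent endomorphism `u` of echelon two (`(u − 1)² = 0`) of finite order `u^N = 1`, `N ≥ 1`, over `ℂ` is `1`
  (`u^N = 1 + N·(u − 1)`).
* §2 `fixedPoints_jacquetModule_eq_bot_of_wild` — for a 2-step filtration datum (`M` acts by `θ₁` on `L ≤ V_N` and by `θ₂` on `V_N ∕ L`) and a subgroup `C ≤ M` on which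
  BOTH `θ₁`, `θ₂` are somewhere non-trivial, `V_N^C = 0`; hence (**WILD LEVEL**) `smoothTrace_indicator_shell_eq_zero_of_wild`: `tr ρ(𝟙_{K_n b K_n}) = 0`.
* §3 `jacquetModule_eq_id_of_exponents_trivial` (**TAMENESS FROM TRIVIAL EXPONENTS**): if `θ₁|_C = θ₂|_C = 1` (`C = K_n ∩ M`, `V_N` finite-dimensional), then `C` acts
  TRIVIALLY on `V_N`: each `ρ_N(k)`, `k ∈ C`, is unipotent of echelon two, and of finite order because a deeper level `K_{n'} ∩ K_n` (★ «LEVEL-DEPTH») acts trivially and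
  has finite index in the compact `K_n` (Mathlib `Subgroup.quotient_finite_of_isOpen`, `Subgroup.exists_pow_mem_of_index_ne_zero`); §1.
* §4 `smoothTrace_indicator_shell_eq_of_tame` (**TAME LEVEL**): if `C` acts trivially on `V_N` and `tr ρ_N(m) = Σ_{θ ∈ s} θ(m)`, then
  `tr ρ(𝟙_{K_n b K_n}) = μ(K_n)·#R·Σ_{θ ∈ s} θ(b)` — ★ R2d at `m = 1` with `[V^{K_n}] = V_N^C = V_N`.
* §5 (ED. 2) `trace_eq_add_of_line_of_sub_mem` (`dim W = 2`, `f = a` on a line `ℓ`, `f ≡ b mod ℓ` ⇒ `tr f = a + b`) and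
  **`smoothTrace_indicator_shell_eq_ite_of_normalizedTwoStep`** — the 2-step form stated on the NORMALISED Jacquet module `r_P(ρ) = ρ_N ⊗ δ_P^{-1/2}` (line character
  `χa`, quotient character `χb`, `dim r_P(ρ) = 2`, `dim ℓ = 1`, `P` closed): `tr ρ(𝟙_{K_n b K_n}) = μ(K_n)·#R·(if χb|_{K_n ∩ M} = 1 then δ_P^{1/2}(b)·(χb(b) + χa(b)) else 0)`
  under `χb|_{K_n∩M} = 1 ↔ χa|_{K_n∩M} = 1` — exactly the currency of the tree's Jacquet-filtration data (★ Keys N1 `n1_line_data` for `i_G(χ)` of `U(Φ₃)`), so that the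
  CM corollary is a one-line application with no rewriting on the CM carriers (`δ_P^{1/2} = 1` on `K_n ∩ M` ★ `rootDeltaChar_eq_one_of_mem_of_isClosed_of_isCompact`).

## References
* [Casselman1977] W. Casselman, *Characters and Jacquet modules*, Math. Ann. 230 (1977) 101–105, Thm. 5.2.
* [Casselman1995] W. Casselman, *Introduction to the theory of admissible representations of `p`-adic reductive groups* (1995 notes), Thm. 3.3.3, Prop. 3.3.6, Prop. 4.1.6.
* [BernsteinZelevinsky1976] I. N. Bernstein, A. V. Zelevinsky, *Representations of the group GL(n,F) where F is a non-archimedean local field*, Russ. Math. Surveys 31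
  (1976), §2.1, §3.16–3.19.
* [Rogawski1990] J. D. Rogawski, Ann. of Math. Stud. 123 (1990), §12.7 p. 193 («by Casselman's theorem χ_π(γ) = χ_{π_N}(γ)»).
-/

set_option autoImplicit false

open scoped BigOperators Pointwise
open MeasureTheory Topology
open Literature.NumberTheory.Automorphic

namespace Representation

/-! ## §1 A unipotent endomorphism of echelon two and finite order is the identity -/

section Unipotent

variable {W : Type*} [AddCommGroup W] [Module ℂ W]

/-- **`(u − 1)² = 0` and `u^N = 1` (`N ≥ 1`) force `u = 1`** over `ℂ`: `u^N = 1 + N·(u − 1)`, so `N·(u − 1) = 0`. [cite: Casselman1995, Thm. 3.3.3] -/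
theorem eq_one_of_sq_sub_one_eq_zero_of_pow_eq_one (u : W →ₗ[ℂ] W) (h2 : (u - 1) * (u - 1) = 0) {N : ℕ} (hN : 0 < N) (hpow : u ^ N = 1) :
    u = 1 := by
  set X : W →ₗ[ℂ] W := u - 1 with hX
  have hXX : X * X = 0 := h2
  have hu : u = 1 + X := by rw [hX, add_sub_cancel]
  -- `(1 + X)^m = 1 + m·X`
  have hpowX : ∀ m : ℕ, (1 + X) ^ m = 1 + (m : ℂ) • X := by
    intro m
    induction m with
    | zero => rw [pow_zero, Nat.cast_zero, zero_smul, add_zero]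
    | succ m ih =>
      calc (1 + X) ^ (m + 1) = (1 + X) ^ m * (1 + X) := pow_succ _ _
        _ = (1 + (m : ℂ) • X) * (1 + X) := by rw [ih]
        _ = 1 + (m : ℂ) • X + X + (m : ℂ) • (X * X) := by
            rw [mul_add, mul_one, add_mul, one_mul, smul_mul_assoc]; abel
        _ = 1 + ((m + 1 : ℕ) : ℂ) • X := by
            rw [hXX, smul_zero, add_zero, Nat.cast_succ, add_smul, one_smul]; abel
  have hN0 : (N : ℂ) ≠ 0 := Nat.cast_ne_zero.2 hN.ne'
  rw [hu, hpowX N] at hpow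
  have hNX : (N : ℂ) • X = 0 := by
    have := congrArg (fun f => f - (1 : W →ₗ[ℂ] W)) hpow
    simpa only [add_sub_cancel_left, sub_self] using this
  have hX0 : X = 0 := by rw [← inv_smul_smul₀ hN0 X, hNX, smul_zero]
  rw [hu, hX0, add_zero]

/-- The trace of the restriction of an endomorphism to the zero submodule vanishes. [folklore] -/
private theorem trace_restrict_eq_zero_of_eq_bot (f : W →ₗ[ℂ] W) {p : Submodule ℂ W} (hf : ∀ x ∈ p, f x ∈ p) (hp : p = ⊥) :
    LinearMap.trace ℂ p (f.restrict hf) = 0 := by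
  subst hp
  have h0 : f.restrict hf = 0 := by
    refine LinearMap.ext fun x => Subtype.ext ?_
    have hx : (x : W) = 0 := (Submodule.mem_bot ℂ).1 x.2
    rw [LinearMap.coe_restrict_apply, LinearMap.zero_apply, hx, map_zero, Submodule.coe_zero]
  rw [h0, map_zero]

end Unipotent

/-! ## §2 Wild level: `V_N^C = 0`, the character vanishes on the shell -/

section Jacquet

variable {G V : Type*} [Group G] [AddCommGroup V] [Module ℂ V] {ρ : Representation ℂ G V}

/-- **`V_N^C = 0` AT A WILD SUBGROUP.**  Let `M` act on `V_N` through a 2-step filtration — by the character `θ₁` on a submodule `L` (`hL`) and by `θ₂` on `V_N ∕ L`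
(`hQ`) — and let `C ≤ M` carry elements `k₁, k₂` with `θ₁ k₁ ≠ 1`, `θ₂ k₂ ≠ 1`.  Then no non-zero vector of `V_N` is fixed by `C` (a fixed `x` has `(1 − θ₂ k₂)x ∈ L`,
so `x ∈ L`, where `θ₁ k₁ x = x` forces `x = 0`). [cite: Casselman1995, Thm. 3.3.3] [cite: BernsteinZelevinsky1976, §3.16] -/
theorem fixedPoints_jacquetModule_eq_bot_of_wild (t : ParabolicTriple G) (C : Subgroup ↥t.M) (θ₁ θ₂ : ↥t.M →* ℂˣ)
    (Lsub : Submodule ℂ (t.restrict ρ).Coinvariants)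
    (hL : ∀ (m : ↥t.M) (x : (t.restrict ρ).Coinvariants), x ∈ Lsub → ρ.jacquetModule t m x = ((θ₁ m : ℂˣ) : ℂ) • x)
    (hQ : ∀ (m : ↥t.M) (x : (t.restrict ρ).Coinvariants), ρ.jacquetModule t m x - ((θ₂ m : ℂˣ) : ℂ) • x ∈ Lsub)
    (hw₁ : ∃ k ∈ C, θ₁ k ≠ 1) (hw₂ : ∃ k ∈ C, θ₂ k ≠ 1) :
    (ρ.jacquetModule t).fixedPoints C = ⊥ := by
  obtain ⟨k₁, hk₁, hθ₁⟩ := hw₁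
  obtain ⟨k₂, hk₂, hθ₂⟩ := hw₂
  rw [eq_bot_iff]
  intro x hx
  rw [Submodule.mem_bot]
  rw [mem_fixedPoints] at hx
  -- `x ∈ L`: `(1 − θ₂ k₂) x ∈ L`
  have hc₂ : (1 : ℂ) - ((θ₂ k₂ : ℂˣ) : ℂ) ≠ 0 := fun h =>
    hθ₂ (Units.val_eq_one.mp (sub_eq_zero.mp h).symm)
  have hxL : x ∈ Lsub := by
    have h := hQ k₂ x
    rw [hx k₂ hk₂] at h
    have h' : ((1 : ℂ) - ((θ₂ k₂ : ℂˣ) : ℂ)) • x ∈ Lsub := by rwa [sub_smul, one_smul]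
    have h'' := Lsub.smul_mem ((1 : ℂ) - ((θ₂ k₂ : ℂˣ) : ℂ))⁻¹ h'
    rwa [inv_smul_smul₀ hc₂] at h''
  -- `θ₁ k₁ x = x` forces `x = 0`
  have h1 := hL k₁ x hxL
  rw [hx k₁ hk₁] at h1
  have hc₁ : ((θ₁ k₁ : ℂˣ) : ℂ) - 1 ≠ 0 := fun h => hθ₁ (Units.val_eq_one.mp (sub_eq_zero.mp h))
  have h3 : (((θ₁ k₁ : ℂˣ) : ℂ) - 1) • x = 0 := by rw [sub_smul, one_smul, ← h1, sub_self]
  rw [← inv_smul_smul₀ hc₁ x, h3, smul_zero]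

end Jacquet

section Shell

variable {G V : Type*} [Group G] [TopologicalSpace G] [IsTopologicalGroup G] [MeasurableSpace G] [BorelSpace G]
  [AddCommGroup V] [Module ℂ V] {ρ : Representation ℂ G V}
  (μ : Measure G) [μ.IsMulLeftInvariant] [IsFiniteMeasureOnCompacts μ]

/-- **WILD LEVEL: `tr ρ(𝟙_{K_n b K_n}) = 0`.**  `ρ` admissible, `𝓘` an Iwahori datum of `t = (P, M, N)` (`N` closed), a 2-step filtration datum `(θ₁, θ₂, L)` of `V_N`
with BOTH `θ₁`, `θ₂` somewhere non-trivial on `C = K_n ∩ M`, `b ∈ M` central in `M` and dominant at level `n`, `R` a left transversal of `K_n ∕ (K_n ∩ bK_nb⁻¹)`: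
★ R2d `smoothTrace_indicator_shell_eq` (`m = 1`) + Jacquet's lemma ★ `range_fixedPointsMk_eq` + §2 (`[V^{K_n}] = V_N^C = 0`).
[cite: Casselman1977, Thm. 5.2] [cite: Casselman1995, Thm. 3.3.3, Prop. 4.1.6] -/
theorem smoothTrace_indicator_shell_eq_zero_of_wild (hadm : ρ.IsAdmissible) (t : ParabolicTriple G) (hN : IsClosed (t.N : Set G))
    (𝓘 : t.IwahoriDatum) (n : ℕ) (θ₁ θ₂ : ↥t.M →* ℂˣ) (Lsub : Submodule ℂ (t.restrict ρ).Coinvariants)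
    (hL : ∀ (m : ↥t.M) (x : (t.restrict ρ).Coinvariants), x ∈ Lsub → ρ.jacquetModule t m x = ((θ₁ m : ℂˣ) : ℂ) • x)
    (hQ : ∀ (m : ↥t.M) (x : (t.restrict ρ).Coinvariants), ρ.jacquetModule t m x - ((θ₂ m : ℂˣ) : ℂ) • x ∈ Lsub)
    (hw₁ : ∃ k : ↥t.M, (k : G) ∈ 𝓘.K n ∧ θ₁ k ≠ 1) (hw₂ : ∃ k : ↥t.M, (k : G) ∈ 𝓘.K n ∧ θ₂ k ≠ 1)
    {b : G} (hbM : b ∈ t.M) (hbcomm : ∀ m ∈ t.M, m * b = b * m) (hbN : ∀ x ∈ 𝓘.K n ⊓ t.N, b * x * b⁻¹ ∈ 𝓘.K n)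
    (hbNbar : ∀ x ∈ 𝓘.K n ⊓ 𝓘.Nbar, b⁻¹ * x * b ∈ 𝓘.K n ⊓ 𝓘.Nbar)
    (hbexh : ∀ x ∈ t.N, ∃ m : ℕ, ∀ m', m ≤ m' → b ^ m' * x * (b ^ m')⁻¹ ∈ 𝓘.K n)
    {R : Finset G} (hR : IsLeftTransversal (𝓘.K n) (𝓘.K n ⊓ ConjAct.toConjAct b • 𝓘.K n) R) :
    ρ.smoothTrace μ ((DoubleCoset.doubleCoset b (𝓘.K n : Set G) (𝓘.K n)).indicator fun _ => (1 : ℂ)) = 0 := by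
  have hR1 : IsLeftTransversal (𝓘.K n) (𝓘.K n ⊓ ConjAct.toConjAct (b ^ 1) • 𝓘.K n) R := by rwa [pow_one]
  have key := smoothTrace_indicator_shell_eq μ hadm t (𝓘.isOpen_K n) (𝓘.isCompact_K n) hN (𝓘.factorization n)
    hbM (fun m hm => hbcomm m (Subgroup.mem_inf.1 hm).2) hbN hbNbar hbexh le_rfl hR1
  rw [pow_one, pow_one] at key
  have hbot : LinearMap.range (ρ.fixedPointsMk t (𝓘.K n)) = ⊥ := by
    rw [range_fixedPointsMk_eq t 𝓘 hadm n]
    obtain ⟨k₁, hk₁, h₁⟩ := hw₁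
    obtain ⟨k₂, hk₂, h₂⟩ := hw₂
    exact fixedPoints_jacquetModule_eq_bot_of_wild t _ θ₁ θ₂ Lsub hL hQ ⟨k₁, Subgroup.mem_comap.mpr hk₁, h₁⟩
      ⟨k₂, Subgroup.mem_comap.mpr hk₂, h₂⟩
  rw [key, trace_restrict_eq_zero_of_eq_bot _ _ hbot, mul_zero]

/-! ## §3 Tameness from trivial exponents: `θ₁|_C = θ₂|_C = 1 ⇒ C` acts trivially on `V_N` -/

omit [MeasurableSpace G] [BorelSpace G] in
/-- **TAMENESS FROM TRIVIAL EXPONENTS.**  `ρ` admissible with finite-dimensional Jacquet module `V_N`, filtered in two steps by `(θ₁, L, θ₂)`; if `θ₁` and `θ₂` are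
TRIVIAL on `C = K_n ∩ M`, then every `k ∈ C` acts as the identity on `V_N`: `u = ρ_N(k)` satisfies `(u − 1)² = 0` (`hL`, `hQ`), and `u^N = 1` for some `N ≥ 1` because
`k^N` lies in a deeper level `K_{n'} ∩ K_n` acting trivially (★ «LEVEL-DEPTH»), which has finite index in the compact group `K_n` (open subgroup); §1.
[cite: Casselman1995, Thm. 3.3.3, Prop. 3.3.6] [cite: BernsteinZelevinsky1976, §2.1] -/
theorem jacquetModule_eq_id_of_exponents_trivial (hadm : ρ.IsAdmissible) (t : ParabolicTriple G) (𝓘 : t.IwahoriDatum)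
    (hfd : FiniteDimensional ℂ (t.restrict ρ).Coinvariants) (n : ℕ) (θ₁ θ₂ : ↥t.M →* ℂˣ) (Lsub : Submodule ℂ (t.restrict ρ).Coinvariants)
    (hL : ∀ (m : ↥t.M) (x : (t.restrict ρ).Coinvariants), x ∈ Lsub → ρ.jacquetModule t m x = ((θ₁ m : ℂˣ) : ℂ) • x)
    (hQ : ∀ (m : ↥t.M) (x : (t.restrict ρ).Coinvariants), ρ.jacquetModule t m x - ((θ₂ m : ℂˣ) : ℂ) • x ∈ Lsub)
    (h₁ : ∀ k : ↥t.M, (k : G) ∈ 𝓘.K n → θ₁ k = 1) (h₂ : ∀ k : ↥t.M, (k : G) ∈ 𝓘.K n → θ₂ k = 1)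
    (k : ↥t.M) (hk : (k : G) ∈ 𝓘.K n) : ρ.jacquetModule t k = LinearMap.id := by
  haveI := hfd
  -- a deeper level `K' = K_{n'} ∩ K_n` acting trivially on `V_N` (★ «LEVEL-DEPTH»)
  obtain ⟨U, hU, hUfix⟩ := exists_nhds_forall_fixedPoints_jacquetModule_eq_top (ρ := ρ) t hadm.1
  obtain ⟨n', hn'⟩ := 𝓘.hasBasis_K U hU
  set K' : Subgroup G := 𝓘.K n' ⊓ 𝓘.K n with hK'
  have hK'U : (K' : Set G) ⊆ U := fun x hx => hn' (Subgroup.mem_inf.1 hx).1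
  have hK'fix : ∀ k' : ↥t.M, (k' : G) ∈ K' → ρ.jacquetModule t k' = LinearMap.id := by
    intro k' hk'
    have htop := hUfix K' hK'U
    refine LinearMap.ext fun x => ?_
    have hx : x ∈ (ρ.jacquetModule t).fixedPoints (K'.comap t.M.subtype) := by rw [htop]; exact Submodule.mem_top
    rw [mem_fixedPoints] at hx
    exact hx k' (Subgroup.mem_comap.mpr hk')
  -- `K'` has finite index in the compact group `K_n`: some positive power of `k` lies in `K'`
  haveI : CompactSpace ↥(𝓘.K n) := isCompact_iff_compactSpace.mp (𝓘.isCompact_K n)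
  have hopen : IsOpen ((K'.subgroupOf (𝓘.K n) : Subgroup ↥(𝓘.K n)) : Set ↥(𝓘.K n)) :=
    ((𝓘.isOpen_K n').inter (𝓘.isOpen_K n)).preimage continuous_subtype_val
  haveI : Finite (↥(𝓘.K n) ⧸ K'.subgroupOf (𝓘.K n)) := Subgroup.quotient_finite_of_isOpen _ hopen
  have hidx : (K'.subgroupOf (𝓘.K n)).index ≠ 0 := Subgroup.index_ne_zero_of_finite
  obtain ⟨N, hNpos, -, hNmem⟩ := Subgroup.exists_pow_mem_of_index_ne_zero hidx ⟨(k : G), hk⟩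
  rw [Subgroup.mem_subgroupOf, SubgroupClass.coe_pow] at hNmem
  -- `u := ρ_N(k)` has `u^N = 1`
  have hpow : (ρ.jacquetModule t k) ^ N = 1 := by
    have h := hK'fix (k ^ N) (by rw [SubgroupClass.coe_pow]; exact hNmem)
    rw [map_pow] at h
    exact h
  -- and `(u − 1)² = 0`
  have h2 : (ρ.jacquetModule t k - 1) * (ρ.jacquetModule t k - 1) = 0 := by
    refine LinearMap.ext fun x => ?_
    have hx1 : (ρ.jacquetModule t k - 1) x ∈ Lsub := by
      have h := hQ k x
      rw [h₂ k hk, Units.val_one, one_smul] at h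
      rw [LinearMap.sub_apply, Module.End.one_apply]
      exact h
    have hy : ∀ y ∈ Lsub, (ρ.jacquetModule t k - 1) y = 0 := fun y hy => by
      rw [LinearMap.sub_apply, Module.End.one_apply, hL k y hy, h₁ k hk, Units.val_one, one_smul, sub_self]
    rw [Module.End.mul_apply, hy _ hx1, LinearMap.zero_apply]
  exact eq_one_of_sq_sub_one_eq_zero_of_pow_eq_one _ h2 hNpos hpow

/-! ## §4 Tame level: the character on the shell is `μ(K_n)·#R·Σ_s θ(b)` -/

/-- **TAME LEVEL: `tr ρ(𝟙_{K_n b K_n}) = μ(K_n) · #R · Σ_{θ ∈ s} θ(b)`.**  `ρ` admissible with `tr ρ_N(m) = Σ_{θ ∈ s} θ(m)` for a multiset `s` of characters of `M`,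
`𝓘` an Iwahori datum of `t = (P, M, N)` (`N` closed), the level `n` TAME (`C = K_n ∩ M` acts trivially on `V_N` — e.g. §3), `b ∈ M` central in `M` and dominant at
level `n`, `R` a left transversal of `K_n ∕ (K_n ∩ bK_nb⁻¹)` (`#R = [K_n b K_n : K_n]`).  ★ R2d at `m = 1` + Jacquet's lemma (`[V^{K_n}] = V_N^C = V_N`) — the
level-`n` form of ★ `F0P3cStCharTSShellKit.smoothTrace_shell_eq_mul_sum` without the depth neighbourhood.
[cite: Casselman1977, Thm. 5.2] [cite: Casselman1995, Thm. 3.3.3, Prop. 4.1.6] [cite: Rogawski1990, §12.7 p. 193] -/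
theorem smoothTrace_indicator_shell_eq_of_tame (hadm : ρ.IsAdmissible) (t : ParabolicTriple G) (hN : IsClosed (t.N : Set G))
    (𝓘 : t.IwahoriDatum) (n : ℕ) (s : Multiset (↥t.M →* ℂˣ))
    (hs : ∀ m : ↥t.M, LinearMap.trace ℂ _ (ρ.jacquetModule t m) = (s.map fun θ : ↥t.M →* ℂˣ => ((θ m : ℂˣ) : ℂ)).sum)
    (htame : ∀ k : ↥t.M, (k : G) ∈ 𝓘.K n → ρ.jacquetModule t k = LinearMap.id)
    {b : G} (hbM : b ∈ t.M) (hbcomm : ∀ m ∈ t.M, m * b = b * m) (hbN : ∀ x ∈ 𝓘.K n ⊓ t.N, b * x * b⁻¹ ∈ 𝓘.K n)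
    (hbNbar : ∀ x ∈ 𝓘.K n ⊓ 𝓘.Nbar, b⁻¹ * x * b ∈ 𝓘.K n ⊓ 𝓘.Nbar)
    (hbexh : ∀ x ∈ t.N, ∃ m : ℕ, ∀ m', m ≤ m' → b ^ m' * x * (b ^ m')⁻¹ ∈ 𝓘.K n)
    {R : Finset G} (hR : IsLeftTransversal (𝓘.K n) (𝓘.K n ⊓ ConjAct.toConjAct b • 𝓘.K n) R) :
    ρ.smoothTrace μ ((DoubleCoset.doubleCoset b (𝓘.K n : Set G) (𝓘.K n)).indicator fun _ => (1 : ℂ)) =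
      (μ.real (𝓘.K n : Set G) : ℂ) * (R.card : ℂ) * (s.map fun θ : ↥t.M →* ℂˣ => ((θ ⟨b, hbM⟩ : ℂˣ) : ℂ)).sum := by
  have hR1 : IsLeftTransversal (𝓘.K n) (𝓘.K n ⊓ ConjAct.toConjAct (b ^ 1) • 𝓘.K n) R := by rwa [pow_one]
  have key := smoothTrace_indicator_shell_eq μ hadm t (𝓘.isOpen_K n) (𝓘.isCompact_K n) hN (𝓘.factorization n)
    hbM (fun m hm => hbcomm m (Subgroup.mem_inf.1 hm).2) hbN hbNbar hbexh le_rfl hR1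
  rw [pow_one, pow_one] at key
  have hrange : LinearMap.range (ρ.fixedPointsMk t (𝓘.K n)) = ⊤ := by
    rw [range_fixedPointsMk_eq t 𝓘 hadm n, eq_top_iff]
    intro x _
    rw [mem_fixedPoints]
    intro m hm
    rw [htame m (Subgroup.mem_comap.mp hm), LinearMap.id_apply]
  -- `V_N = [V^{K_n}]` is then finite-dimensional (admissibility)
  haveI := finite_fixedPoints_of_isAdmissible hadm (𝓘.isCompact_K n) (𝓘.isOpen_K n)
  haveI : Module.Finite ℂ (t.restrict ρ).Coinvariants :=
    Module.Finite.of_surjective (ρ.fixedPointsMk t (𝓘.K n)) (LinearMap.range_eq_top.mp hrange)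
  rw [key, LinearMap.trace_restrict_eq_of_forall_mem _ _ (fun x => Submodule.eq_top_iff'.1 hrange _), hs ⟨b, hbM⟩]

open scoped Classical in
/-- **THE 2-STEP CASE, BOTH LEVEL TYPES IN ONE STATEMENT** (the shape road (D) D3-ii consumes): `ρ` admissible, `V_N` finite-dimensional with `tr ρ_N(m) = θ₁(m) + θ₂(m)`
and the 2-step filtration `(θ₁, L, θ₂)`; `C = K_n ∩ M` such that `θ₁|_C = 1 ↔ θ₂|_C = 1` (e.g. `C` stable under an element swapping the exponents); then
`tr ρ(𝟙_{K_n b K_n}) = μ(K_n)·#R·(θ₁(b) + θ₂(b))` if `θ₁|_C = 1`, and `= 0` otherwise (§3 + §4, resp. §2).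
[cite: Casselman1977, Thm. 5.2] [cite: Casselman1995, Thm. 3.3.3, Prop. 4.1.6] [cite: Rogawski1990, §12.7 p. 193] -/
theorem smoothTrace_indicator_shell_eq_ite_of_twoStep (hadm : ρ.IsAdmissible) (t : ParabolicTriple G) (hN : IsClosed (t.N : Set G))
    (𝓘 : t.IwahoriDatum) (hfd : FiniteDimensional ℂ (t.restrict ρ).Coinvariants) (n : ℕ) (θ₁ θ₂ : ↥t.M →* ℂˣ)
    (Lsub : Submodule ℂ (t.restrict ρ).Coinvariants)
    (hL : ∀ (m : ↥t.M) (x : (t.restrict ρ).Coinvariants), x ∈ Lsub → ρ.jacquetModule t m x = ((θ₁ m : ℂˣ) : ℂ) • x)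
    (hQ : ∀ (m : ↥t.M) (x : (t.restrict ρ).Coinvariants), ρ.jacquetModule t m x - ((θ₂ m : ℂˣ) : ℂ) • x ∈ Lsub)
    (hs : ∀ m : ↥t.M, LinearMap.trace ℂ _ (ρ.jacquetModule t m) = ((θ₁ m : ℂˣ) : ℂ) + ((θ₂ m : ℂˣ) : ℂ))
    (hiff : (∀ k : ↥t.M, (k : G) ∈ 𝓘.K n → θ₁ k = 1) ↔ (∀ k : ↥t.M, (k : G) ∈ 𝓘.K n → θ₂ k = 1))
    {b : G} (hbM : b ∈ t.M) (hbcomm : ∀ m ∈ t.M, m * b = b * m) (hbN : ∀ x ∈ 𝓘.K n ⊓ t.N, b * x * b⁻¹ ∈ 𝓘.K n)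
    (hbNbar : ∀ x ∈ 𝓘.K n ⊓ 𝓘.Nbar, b⁻¹ * x * b ∈ 𝓘.K n ⊓ 𝓘.Nbar)
    (hbexh : ∀ x ∈ t.N, ∃ m : ℕ, ∀ m', m ≤ m' → b ^ m' * x * (b ^ m')⁻¹ ∈ 𝓘.K n)
    {R : Finset G} (hR : IsLeftTransversal (𝓘.K n) (𝓘.K n ⊓ ConjAct.toConjAct b • 𝓘.K n) R) :
    ρ.smoothTrace μ ((DoubleCoset.doubleCoset b (𝓘.K n : Set G) (𝓘.K n)).indicator fun _ => (1 : ℂ)) =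
      (μ.real (𝓘.K n : Set G) : ℂ) * (R.card : ℂ) *
        (if (∀ k : ↥t.M, (k : G) ∈ 𝓘.K n → θ₁ k = 1) then ((θ₁ ⟨b, hbM⟩ : ℂˣ) : ℂ) + ((θ₂ ⟨b, hbM⟩ : ℂˣ) : ℂ) else 0) := by
  by_cases htriv : ∀ k : ↥t.M, (k : G) ∈ 𝓘.K n → θ₁ k = 1
  · rw [if_pos htriv]
    have htame := jacquetModule_eq_id_of_exponents_trivial hadm t 𝓘 hfd n θ₁ θ₂ Lsub hL hQ htriv (hiff.mp htriv)
    have key := smoothTrace_indicator_shell_eq_of_tame μ hadm t hN 𝓘 n ({θ₁} + {θ₂} : Multiset (↥t.M →* ℂˣ))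
      (fun m => by rw [hs m, Multiset.map_add, Multiset.map_singleton, Multiset.map_singleton, Multiset.sum_add,
        Multiset.sum_singleton, Multiset.sum_singleton]) htame hbM hbcomm hbN hbNbar hbexh hR
    rw [key, Multiset.map_add, Multiset.map_singleton, Multiset.map_singleton, Multiset.sum_add, Multiset.sum_singleton,
      Multiset.sum_singleton]
  · rw [if_neg htriv, mul_zero]
    have hw₂ : ∃ k : ↥t.M, (k : G) ∈ 𝓘.K n ∧ θ₂ k ≠ 1 := by
      by_contra hcon
      push Not at hcon
      exact htriv (hiff.mpr hcon)
    push Not at htriv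
    exact smoothTrace_indicator_shell_eq_zero_of_wild μ hadm t hN 𝓘 n θ₁ θ₂ Lsub hL hQ htriv hw₂ hbM hbcomm hbN hbNbar hbexh hR

/-! ## §5 (ED. 2) The 2-step form on the NORMALISED Jacquet module -/

/-- **`tr f = a + b`** for an endomorphism `f` of a `2`-dimensional space acting by the scalar `a` on a line `ℓ` and by `b` modulo `ℓ`: `g := f − b·1` maps `W` into `ℓ`
and restricts to `(a − b)·1` on `ℓ`, so `tr g = tr (g|^ℓ ∘ ι_ℓ) = a − b` (`tr (ι ∘ g') = tr (g' ∘ ι)`, Mathlib `LinearMap.trace_comp_comm'`) and `tr f = (a − b) + 2b`.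
[cite: Casselman1995, Thm. 3.3.3] -/
theorem trace_eq_add_of_line_of_sub_mem {W : Type*} [AddCommGroup W] [Module ℂ W] [FiniteDimensional ℂ W] (f : W →ₗ[ℂ] W)
    (h2 : Module.finrank ℂ W = 2) (ℓ : Submodule ℂ W) (hℓ : Module.finrank ℂ ℓ = 1) (a b : ℂ)
    (hL : ∀ x ∈ ℓ, f x = a • x) (hQ : ∀ x : W, f x - b • x ∈ ℓ) :
    LinearMap.trace ℂ W f = a + b := by
  -- `g := f − b·1` lands in `ℓ`
  have hgmem : ∀ x, (f - b • (1 : W →ₗ[ℂ] W)) x ∈ ℓ := fun x => by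
    rw [LinearMap.sub_apply, LinearMap.smul_apply, Module.End.one_apply]
    exact hQ x
  have hfac : f - b • (1 : W →ₗ[ℂ] W) = ℓ.subtype ∘ₗ LinearMap.codRestrict ℓ (f - b • (1 : W →ₗ[ℂ] W)) hgmem :=
    LinearMap.ext fun _ => rfl
  -- on `ℓ` it is `(a − b)·1`
  have hcomp : LinearMap.codRestrict ℓ (f - b • (1 : W →ₗ[ℂ] W)) hgmem ∘ₗ ℓ.subtype = (a - b) • (1 : ℓ →ₗ[ℂ] ℓ) := by
    refine LinearMap.ext fun y => Subtype.ext ?_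
    rw [LinearMap.comp_apply, LinearMap.codRestrict_apply, LinearMap.smul_apply, Module.End.one_apply, Submodule.coe_smul,
      Submodule.coe_subtype, LinearMap.sub_apply, LinearMap.smul_apply, Module.End.one_apply, hL y y.2, sub_smul]
  have htg : LinearMap.trace ℂ W (f - b • (1 : W →ₗ[ℂ] W)) = a - b := by
    rw [hfac, LinearMap.trace_comp_comm', hcomp, map_smul, LinearMap.trace_one, hℓ, Nat.cast_one, smul_eq_mul, mul_one]
  have hf : f = (f - b • (1 : W →ₗ[ℂ] W)) + b • (1 : W →ₗ[ℂ] W) := (sub_add_cancel f _).symm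
  rw [hf, map_add, htg, map_smul, LinearMap.trace_one, h2, smul_eq_mul, Nat.cast_ofNat]
  ring

open scoped Classical in
/-- **THE 2-STEP CASE ON THE NORMALISED JACQUET MODULE** (ED. 2; the shape of the tree's filtration data, e.g. ★ Keys N1 `n1_line_data` for `i_G(χ₁, χ₂)` of `U(Φ₃)(L⁺_v)`):
`ρ` admissible, `t = (P, M, N)` with `P` and `N` closed, `r_P(ρ) = ρ_N ⊗ δ_P^{-1/2}` two-dimensional with an `M`-line `ℓ` of character `χa` and quotient character `χb`
(normalised action ★ `normalizedJacquet`), `𝓘` an Iwahori datum, `n` a level with `χb|_{K_n ∩ M} = 1 ↔ χa|_{K_n ∩ M} = 1`, `b ∈ M` central in `M` and dominant at level `n`,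
`R` a left transversal of `K_n ∕ (K_n ∩ bK_nb⁻¹)`.  Then
`tr ρ(𝟙_{K_n b K_n}; μ) = μ(K_n) · #R · (if χb|_{K_n ∩ M} = 1 then δ_P^{1/2}(b) · (χb(b) + χa(b)) else 0)`.
Proof: un-normalise (★ `normalizedJacquet_apply`: `ρ_N` acts by `θ₁ = δ_P^{1/2}χa` on `ℓ`, by `θ₂ = δ_P^{1/2}χb` modulo `ℓ`), `tr ρ_N(m) = θ₁(m) + θ₂(m)` (`trace_eq_add_of_line_of_sub_mem`),
`δ_P^{1/2} = 1` on `K_n ∩ M` (★ `rootDeltaChar_eq_one_of_mem_of_isClosed_of_isCompact`), and §2–§4 (`smoothTrace_indicator_shell_eq_ite_of_twoStep`).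
[cite: Casselman1977, Thm. 5.2] [cite: Casselman1995, Thm. 3.3.3, Prop. 4.1.6; Lemma 7.1.1 (a)] [cite: Rogawski1990, §12.2 pp. 173–174; §12.7 p. 193] -/
theorem smoothTrace_indicator_shell_eq_ite_of_normalizedTwoStep (hadm : ρ.IsAdmissible) (t : ParabolicTriple G) [LocallyCompactSpace ↥t.P]
    (hP : IsClosed (t.P : Set G)) (hN : IsClosed (t.N : Set G)) (𝓘 : t.IwahoriDatum) (n : ℕ)
    (hfd : FiniteDimensional ℂ (t.restrict ρ).Coinvariants) (h2 : Module.finrank ℂ (t.restrict ρ).Coinvariants = 2)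
    (Lsub : Submodule ℂ (t.restrict ρ).Coinvariants) (hL1 : Module.finrank ℂ Lsub = 1) (χa χb : ↥t.M →* ℂˣ)
    (hL : ∀ (m : ↥t.M), ∀ x ∈ Lsub, ρ.normalizedJacquet t m x = ((χa m : ℂˣ) : ℂ) • x)
    (hQ : ∀ (m : ↥t.M) (x : (t.restrict ρ).Coinvariants), ρ.normalizedJacquet t m x - ((χb m : ℂˣ) : ℂ) • x ∈ Lsub)
    (hiff : (∀ k : ↥t.M, (k : G) ∈ 𝓘.K n → χb k = 1) ↔ (∀ k : ↥t.M, (k : G) ∈ 𝓘.K n → χa k = 1))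
    {b : G} (hbM : b ∈ t.M) (hbcomm : ∀ m ∈ t.M, m * b = b * m) (hbN : ∀ x ∈ 𝓘.K n ⊓ t.N, b * x * b⁻¹ ∈ 𝓘.K n)
    (hbNbar : ∀ x ∈ 𝓘.K n ⊓ 𝓘.Nbar, b⁻¹ * x * b ∈ 𝓘.K n ⊓ 𝓘.Nbar)
    (hbexh : ∀ x ∈ t.N, ∃ m : ℕ, ∀ m', m ≤ m' → b ^ m' * x * (b ^ m')⁻¹ ∈ 𝓘.K n)
    {R : Finset G} (hR : IsLeftTransversal (𝓘.K n) (𝓘.K n ⊓ ConjAct.toConjAct b • 𝓘.K n) R) :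
    ρ.smoothTrace μ ((DoubleCoset.doubleCoset b (𝓘.K n : Set G) (𝓘.K n)).indicator fun _ => (1 : ℂ)) =
      (μ.real (𝓘.K n : Set G) : ℂ) * (R.card : ℂ) *
        (if (∀ k : ↥t.M, (k : G) ∈ 𝓘.K n → χb k = 1) then
          ((rootDeltaChar t.P (Subgroup.inclusion t.M_le ⟨b, hbM⟩) : ℂˣ) : ℂ) * (((χb ⟨b, hbM⟩ : ℂˣ) : ℂ) + ((χa ⟨b, hbM⟩ : ℂˣ) : ℂ))
        else 0) := by
  haveI := hfd
  -- un-normalised exponents `θ₁ = δ^{1/2}·χa` (line), `θ₂ = δ^{1/2}·χb` (quotient)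
  have hL' : ∀ (m : ↥t.M), ∀ x ∈ Lsub, ρ.jacquetModule t m x =
      (((((rootDeltaChar t.P).comp (Subgroup.inclusion t.M_le)) * χa) m : ℂˣ) : ℂ) • x := by
    intro m x hx
    rw [jacquetModule_apply_eq_smul_of_normalizedJacquet t (fun m' => hL m' x hx) m, MonoidHom.mul_apply, MonoidHom.comp_apply, Units.val_mul]
  have hQ' : ∀ (m : ↥t.M) (x : (t.restrict ρ).Coinvariants), ρ.jacquetModule t m x -
      (((((rootDeltaChar t.P).comp (Subgroup.inclusion t.M_le)) * χb) m : ℂˣ) : ℂ) • x ∈ Lsub := by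
    intro m x
    have h := Lsub.smul_mem (((rootDeltaChar t.P (Subgroup.inclusion t.M_le m)) : ℂˣ) : ℂ) (hQ m x)
    rw [smul_sub, normalizedJacquet_apply, smul_smul, Units.mul_inv, one_smul, smul_smul] at h
    rw [MonoidHom.mul_apply, MonoidHom.comp_apply, Units.val_mul]
    exact h
  have hs : ∀ m : ↥t.M, LinearMap.trace ℂ _ (ρ.jacquetModule t m) =
      (((((rootDeltaChar t.P).comp (Subgroup.inclusion t.M_le)) * χa) m : ℂˣ) : ℂ) + (((((rootDeltaChar t.P).comp (Subgroup.inclusion t.M_le)) * χb) m : ℂˣ) : ℂ) :=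
    fun m => trace_eq_add_of_line_of_sub_mem _ h2 Lsub hL1 _ _ (hL' m) (hQ' m)
  -- `δ^{1/2} = 1` on `K_n ∩ M`
  have hδ : ∀ k : ↥t.M, (k : G) ∈ 𝓘.K n → rootDeltaChar t.P (Subgroup.inclusion t.M_le k) = 1 := fun k hk =>
    rootDeltaChar_eq_one_of_mem_of_isClosed_of_isCompact t.P hP (𝓘.isCompact_K n) hk
  have hiffa : (∀ k : ↥t.M, (k : G) ∈ 𝓘.K n → (((rootDeltaChar t.P).comp (Subgroup.inclusion t.M_le)) * χa) k = 1) ↔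
      (∀ k : ↥t.M, (k : G) ∈ 𝓘.K n → χa k = 1) :=
    forall_congr' fun k => imp_congr_right fun hk => by rw [MonoidHom.mul_apply, MonoidHom.comp_apply, hδ k hk, one_mul]
  have hiffb : (∀ k : ↥t.M, (k : G) ∈ 𝓘.K n → (((rootDeltaChar t.P).comp (Subgroup.inclusion t.M_le)) * χb) k = 1) ↔
      (∀ k : ↥t.M, (k : G) ∈ 𝓘.K n → χb k = 1) :=
    forall_congr' fun k => imp_congr_right fun hk => by rw [MonoidHom.mul_apply, MonoidHom.comp_apply, hδ k hk, one_mul]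
  have hiff' : (∀ k : ↥t.M, (k : G) ∈ 𝓘.K n → (((rootDeltaChar t.P).comp (Subgroup.inclusion t.M_le)) * χa) k = 1) ↔
      (∀ k : ↥t.M, (k : G) ∈ 𝓘.K n → (((rootDeltaChar t.P).comp (Subgroup.inclusion t.M_le)) * χb) k = 1) :=
    hiffa.trans (hiff.symm.trans hiffb.symm)
  rw [smoothTrace_indicator_shell_eq_ite_of_twoStep μ hadm t hN 𝓘 hfd n _ _ Lsub hL' hQ' hs hiff' hbM hbcomm hbN hbNbar hbexh hR]
  by_cases hb : ∀ k : ↥t.M, (k : G) ∈ 𝓘.K n → χb k = 1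
  · rw [if_pos (hiffa.mpr (hiff.mp hb)), if_pos hb, MonoidHom.mul_apply, MonoidHom.mul_apply, MonoidHom.comp_apply, Units.val_mul, Units.val_mul]
    ring
  · rw [if_neg (fun h => hb (hiff.mpr (hiffa.mp h))), if_neg hb]

end Shell

end Representation
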